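import Summits.HodgeConjecture.CorCM.Census.DicyclicTwistBlocks

/-!
# The dicyclic twist `Dic(A) ⊃ ℤ/2 × A`, XI: the generating family — one reducing face per non-residual block and the two closing
squares; `μ(Dic(A)) ≤ β − 1`

COR-CM (cell `pub-hodgecm2`, stage 2 of the Hodge ladder), count-neutral KERNEL COMBINATORICS by the binder seat b23 (gen 42; claim
DICYCLIC-COLUMN, HOME/INBOX.md l.10328): part XI (last) of the lane `DicyclicTwist*`.  Bookkeeping definitions with bodies (`rep`, `blockFace`,
`blockSpan`, `family`) + theorems on top of parts I–X; no `decide` table, no certificate, no named fact, no geometry, no `sorry`.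
`Interfaces.lean` (C1), every E term, B01, `Transposition/*`, `PortJoin/*` untouched.
HONEST FRAMING: `HC_CM` is NOT proved, here or anywhere in the tree; nothing here is a period, a count of record or a headline.

CONTENT.  §1 Motions transport covering vectors (`cover_translH`, `cover_translX`) and killed vectors (`killed_translH`: `U s ∘ h`
is `± U (s + t)`, `C ∘ h = ± C`); the `x`-translate of a reducing face is again a face whose active flips stay in a half, so it is killed too
(`killed_translX_redFace`).  §2 THE FAMILY: pick one label `rep B` in every non-residual block `B` (potential `≥ 2`) and let `blockSpan` be
the span of the `G`-translates `h·F_B`, `h·x·F_B` of the reducing faces `F_B = redFace (rep B)`; it is an admissible `S` for the generation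
theorem IX (`hodge₂_le`), whence **`H₂ = P₂ ⊔ blockSpan ⊔ closingSpan`** (`hodge₂_le_blockSpan`, `sup_blockSpan_eq_hodge₂`).
§3 THE COUNT: the finite family `family = {F_B : B non-residual} ∪ {f₁, f₂}` consists of rank-four face classes, its `G`-translates together
with the pairs span `H₂`, and **`#family + 1 ≤ β = #Block A`** (`exists_generating_family`): in the census dictionary (successor file
`CorCM/FaceDicyclicTwistGeneration.lean`) this is `μ(Dic(A), c) ≤ β − 1` for every odd abelian `A` with `|A| ≥ 3`.  All [folklore].

## References
* [Milne1999] J. S. Milne, Lefschetz motives and the Tate conjecture, Compositio Math. 117 (1999), Prop. 2.1, p. 54.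
-/

namespace Summit.HodgeConjecture.CorCM.Census.DicyclicTwist

open Finset
open Summit.HodgeConjecture.CorCM.Census.OddSliceFacesModel
open Summit.HodgeConjecture.CorCM.Census.OddSliceFacesSquares
open Summit.HodgeConjecture.CorCM.Census.OddSliceFacesDescent
open Summit.HodgeConjecture.CorCM.Census.EvenSliceFacesDescent
open Summit.HodgeConjecture.CorCM.Census.OddSliceFacesGenerate

variable (A : Type) [AddCommGroup A] [Fintype A] [DecidableEq A]

/-! ## §1 Motions transport covering vectors and killed vectors -/

omit [DecidableEq A] in
/-- **An `h`-translate of a vector covering `Φ` covers `h·Φ`.** [folklore] -/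
theorem cover_translH {v : Ty₂ A → ℤ} {Φ : Ty₂ A} (hv : v Φ = 1 ∧ ∀ χ, χ ≠ Φ → v χ ≠ 0 → pot A χ < pot A Φ) (g : ZMod 2 × A) :
    translH A g v (twH A g Φ) = 1 ∧ ∀ χ, χ ≠ twH A g Φ → translH A g v χ ≠ 0 → pot A χ < pot A (twH A g Φ) := by
  have e : ∀ χ, translH A g v χ = v (twH A (-g) χ) := fun χ => rfl
  refine ⟨?_, fun χ hχ hne => ?_⟩
  · rw [e, twH_twH, add_neg_cancel, twH_zero]; exact hv.1
  · rw [e] at hne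
    have hχ' : twH A (-g) χ ≠ Φ := fun h => hχ (by rw [← h, twH_twH, neg_add_cancel, twH_zero])
    have := hv.2 _ hχ' hne
    rw [pot_twH] at this
    rw [pot_twH]
    exact this

omit [DecidableEq A] in
/-- **The `x`-translate of a vector covering `Φ` covers `x·Φ`.** [folklore] -/
theorem cover_translX {v : Ty₂ A → ℤ} {Φ : Ty₂ A} (hv : v Φ = 1 ∧ ∀ χ, χ ≠ Φ → v χ ≠ 0 → pot A χ < pot A Φ) :
    translX A v (twX A Φ) = 1 ∧ ∀ χ, χ ≠ twX A Φ → translX A v χ ≠ 0 → pot A χ < pot A (twX A Φ) := by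
  have e : ∀ χ, translX A v χ = v (twXinv A χ) := fun χ => rfl
  refine ⟨?_, fun χ hχ hne => ?_⟩
  · rw [e, twXinv_twX]; exact hv.1
  · rw [e] at hne
    have hχ' : twXinv A χ ≠ Φ := fun h => hχ (by rw [← h, twX_twXinv])
    have := hv.2 _ hχ' hne
    have hp : pot A (twX A (twXinv A χ)) = pot A (twXinv A χ) := pot_twX A _
    rw [twX_twXinv] at hp
    rw [pot_twX, hp]
    exact this

omit [DecidableEq A] [Fintype A] in
/-- Translations compose: `h·(h'·w) = (h + h')·w`. [folklore] -/
theorem translH_translH (g h : ZMod 2 × A) (w : Ty₂ A → ℤ) : translH A g (translH A h w) = translH A (g + h) w := by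
  funext Ψ
  show w (twH A (-h) (twH A (-g) Ψ)) = w (twH A (-(g + h)) Ψ)
  rw [twH_twH, neg_add]

/-- **`U s (c·w) = −U s w`** (`c = (1,0)`, `|A|` odd). [folklore] -/
theorem U_translH_one_zero (hA : Odd (Fintype.card A)) (s : A) (w : Ty₂ A → ℤ) : U A s (translH A (1, 0) w) = -U A s w := by
  show uwt A s ⬝ᵥ translH A (1, 0) w = -(uwt A s ⬝ᵥ w)
  have e : translH A (1, 0) w = w ∘ (twHEquiv A (1, 0)).symm := rfl
  rw [e, dotProduct_comp_equiv_symm, ← neg_dotProduct]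
  congr 1
  funext Ψ
  show uwt A s (twH A (1, 0) Ψ) = -uwt A s Ψ
  rw [twH_one_zero]
  exact uwt_conj A hA s Ψ.1 Ψ.2

/-- **`U' s (c·w) = −U' s w`.** [folklore] -/
theorem U'_translH_one_zero (hA : Odd (Fintype.card A)) (s : A) (w : Ty₂ A → ℤ) : U' A s (translH A (1, 0) w) = -U' A s w := by
  show (fun Ψ : Ty₂ A => uwt A s (Ψ.2, Ψ.1)) ⬝ᵥ translH A (1, 0) w = -((fun Ψ : Ty₂ A => uwt A s (Ψ.2, Ψ.1)) ⬝ᵥ w)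
  have e : translH A (1, 0) w = w ∘ (twHEquiv A (1, 0)).symm := rfl
  rw [e, dotProduct_comp_equiv_symm, ← neg_dotProduct]
  congr 1
  funext Ψ
  show uwt A s ((twH A (1, 0) Ψ).2, (twH A (1, 0) Ψ).1) = -uwt A s (Ψ.2, Ψ.1)
  rw [twH_one_zero]
  exact uwt_conj A hA s Ψ.2 Ψ.1

/-- **`C₁ (h·w) = ± C₁ w`.** [folklore] -/
theorem C₁_translH (hA : Odd (Fintype.card A)) (g : ZMod 2 × A) (w : Ty₂ A → ℤ) :
    C₁ A (translH A g w) = (if g.1 = 0 then 1 else -1) * C₁ A w := by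
  rw [C₁_apply, C₁_apply, marg₁_translH, Cfun_transl A hA]

/-- **`C₀ (h·w) = ± C₀ w`.** [folklore] -/
theorem C₀_translH (hA : Odd (Fintype.card A)) (g : ZMod 2 × A) (w : Ty₂ A → ℤ) :
    C₀ A (translH A g w) = (if g.1 = 0 then 1 else -1) * C₀ A w := by
  rw [C₀_apply, C₀_apply, marg₀_translH, Cfun_transl A hA]

/-- **Translates of killed vectors are killed.** [folklore] -/
theorem killed_translH (hA : Odd (Fintype.card A)) (g : ZMod 2 × A) {w : Ty₂ A → ℤ}
    (hw : ((∀ s, U A s w = 0) ∧ (∀ s, U' A s w = 0) ∧ C₀ A w = 0 ∧ C₁ A w = 0)) :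
    ((∀ s, U A s (translH A g w) = 0) ∧ (∀ s, U' A s (translH A g w) = 0) ∧ C₀ A (translH A g w) = 0 ∧ C₁ A (translH A g w) = 0) := by
  obtain ⟨a, t⟩ := g
  have e : translH A (a, t) w = translH A (0, t) (translH A (a, 0) w) := by
    rw [translH_translH]
    congr 1
    ext <;> simp
  have h01 : ∀ u : ZMod 2, u = 0 ∨ u = 1 := by decide
  have hUU' : (∀ s, U A s (translH A (a, t) w) = 0) ∧ (∀ s, U' A s (translH A (a, t) w) = 0) := by
    rcases h01 a with rfl | rfl
    · have e0 : translH A ((0 : ZMod 2), (0 : A)) w = w := translH_zero A w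
      refine ⟨fun s => ?_, fun s => ?_⟩
      · rw [e, U_translH_zero, e0]; exact hw.1 _
      · rw [e, U'_translH_zero, e0]; exact hw.2.1 _
    · refine ⟨fun s => ?_, fun s => ?_⟩
      · rw [e, U_translH_zero, U_translH_one_zero A hA, hw.1, neg_zero]
      · rw [e, U'_translH_zero, U'_translH_one_zero A hA, hw.2.1, neg_zero]
  exact ⟨hUU'.1, hUU'.2, by rw [C₀_translH A hA, hw.2.2.1, mul_zero], by rw [C₁_translH A hA, hw.2.2.2, mul_zero]⟩

/-- The functionals kill every reducing face (parts IV). [folklore] -/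
theorem killed_redFace (hA : Odd (Fintype.card A)) {Ψ : Ty₂ A} (h : 2 ≤ pot A Ψ) :
    ((∀ s, U A s (redFace A Ψ) = 0) ∧ (∀ s, U' A s (redFace A Ψ) = 0) ∧ C₀ A (redFace A Ψ) = 0 ∧ C₁ A (redFace A Ψ) = 0) :=
  ⟨fun s => U_redFace A hA s h, fun s => U'_redFace A hA s h, C₀_redFace A hA h, C₁_redFace A hA h⟩

/-- Half transfer under reversal: one flip. [folklore] -/
theorem half_rev {φ : Ty A} {i : A} (h : (wt A (φ + δ A i) ≤ Fintype.card A / 2) ↔ (wt A φ ≤ Fintype.card A / 2)) :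
    (wt A (rev A φ + δ A (-i)) ≤ Fintype.card A / 2) ↔ (wt A (rev A φ) ≤ Fintype.card A / 2) := by
  rw [← rev_add_delta, wt_rev, wt_rev]; exact h

/-- Half transfer under reversal: two flips. [folklore] -/
theorem half_rev₂ {φ : Ty A} {i j : A} (h : (wt A (φ + δ A i + δ A j) ≤ Fintype.card A / 2) ↔ (wt A φ ≤ Fintype.card A / 2)) :
    (wt A (rev A φ + δ A (-i) + δ A (-j)) ≤ Fintype.card A / 2) ↔ (wt A (rev A φ) ≤ Fintype.card A / 2) := by
  rw [← rev_add_delta, ← rev_add_delta, wt_rev, wt_rev]; exact h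

/-- Half transfer under reversal-and-conjugation: one flip (`|A|` odd). [folklore] -/
theorem half_rev_one (hA : Odd (Fintype.card A)) {φ : Ty A} {i : A} (h : (wt A (φ + δ A i) ≤ Fintype.card A / 2) ↔ (wt A φ ≤ Fintype.card A / 2)) :
    (wt A (rev A φ + 1 + δ A (-i)) ≤ Fintype.card A / 2) ↔ (wt A (rev A φ + 1) ≤ Fintype.card A / 2) := by
  obtain ⟨K, hK⟩ := hA
  have hw := wt_le A (φ + δ A i)
  have hw' := wt_le A φ
  rw [add_right_comm, ← rev_add_delta, wt_add_one, wt_add_one, wt_rev, wt_rev]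
  omega

/-- Half transfer under reversal-and-conjugation: two flips (`|A|` odd). [folklore] -/
theorem half_rev_one₂ (hA : Odd (Fintype.card A)) {φ : Ty A} {i j : A} (h : (wt A (φ + δ A i + δ A j) ≤ Fintype.card A / 2) ↔ (wt A φ ≤ Fintype.card A / 2)) :
    (wt A (rev A φ + 1 + δ A (-i) + δ A (-j)) ≤ Fintype.card A / 2) ↔ (wt A (rev A φ + 1) ≤ Fintype.card A / 2) := by
  obtain ⟨K, hK⟩ := hA
  have hw := wt_le A (φ + δ A i + δ A j)
  have hw' := wt_le A φ
  have e : rev A φ + 1 + δ A (-i) + δ A (-j) = rev A (φ + δ A i + δ A j) + 1 := by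
    rw [rev_add_delta, rev_add_delta]; abel
  rw [e, wt_add_one, wt_add_one, wt_rev, wt_rev]
  omega

/-- **The `x`-translate of a reducing face is killed by all the functionals** (`|A|` odd): it is again a face whose active flips stay in a
half. [folklore] -/
theorem killed_translX_redFace (hA : Odd (Fintype.card A)) {Ψ : Ty₂ A} (h : 2 ≤ pot A Ψ) :
    ((∀ s, U A s (translX A (redFace A Ψ)) = 0) ∧ (∀ s, U' A s (translX A (redFace A Ψ)) = 0) ∧
      C₀ A (translX A (redFace A Ψ)) = 0 ∧ C₁ A (translX A (redFace A Ψ)) = 0) := by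
  obtain ⟨ψ₀, ψ₁⟩ := Ψ
  have hp : pot A (ψ₀, ψ₁) = clsTy A ψ₀ + clsTy A ψ₁ := rfl
  by_cases h0 : 2 ≤ clsTy A ψ₀
  · obtain ⟨eP, eF⟩ := redFace_eq₀ A (ψ₁ := ψ₁) h0
    obtain ⟨hij, -, -, -, l1, l2, l3⟩ := (exists_two_reducing A h0).choose_spec
    rw [eF, eP, translX_faceVec₀]
    have hij' : -(exists_two_reducing A h0).choose.1 ≠ -(exists_two_reducing A h0).choose.2 := neg_injective.ne hij
    have l1' := half_rev_one A hA l1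
    have l2' := half_rev_one A hA l2
    have l3' := half_rev_one₂ A hA l3
    refine ⟨fun s => U_faceVec₁ A hA s _ hij' l1' l2' l3', fun s => U'_faceVec₁ A hA s _ l1' l2' l3', C₀_faceVec₁ A hA _ _ _ _, ?_⟩
    rw [C₁_faceVec₁ A hA]; exact cwt_square A hij' l1' l2' l3'
  · by_cases h1 : 2 ≤ clsTy A ψ₁
    · obtain ⟨eP, eF⟩ := redFace_eq₁ A h0 h1
      obtain ⟨hij, -, -, -, l1, l2, l3⟩ := (exists_two_reducing A h1).choose_spec
      rw [eF, eP, translX_faceVec₁]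
      have hij' : -(exists_two_reducing A h1).choose.1 ≠ -(exists_two_reducing A h1).choose.2 := neg_injective.ne hij
      have l1' := half_rev A l1
      have l2' := half_rev A l2
      have l3' := half_rev₂ A l3
      refine ⟨fun s => U_faceVec₀ A hA s _ l1' l2' l3', fun s => U'_faceVec₀ A hA s _ hij' l1' l2' l3', ?_, C₁_faceVec₀ A hA _ _ _ _⟩
      rw [C₀_faceVec₀ A hA]; exact cwt_square A hij' l1' l2' l3'
    · have h2 : clsTy A ψ₀ = 1 ∧ clsTy A ψ₁ = 1 := by rw [hp] at h; omega
      obtain ⟨eP, eF⟩ := redFace_eqM A h0 h1 h2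
      have hs := (exists_one_reducing A h2.1).choose_spec.2
      have ht := (exists_one_reducing A h2.2).choose_spec.2
      rw [eF, eP, translX_faceVecM]
      refine ⟨fun s => U_faceVecM A hA s _ _ (half_rev A ht), fun s => U'_faceVecM A hA s _ _ (half_rev_one A hA hs), ?_, ?_⟩
      · rw [C₀_apply, marg₀_faceVecM, map_add, Cfun_pairVec A hA, Cfun_pairVec A hA, add_zero]
      · rw [C₁_apply, marg₁_faceVecM, map_add, Cfun_pairVec A hA, Cfun_pairVec A hA, add_zero]

/-! ## §2 The family: one reducing face per non-residual block -/

/-- A label in each block (a choice). [folklore] -/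
noncomputable def rep (B : Block A) : Ty₂ A := Quotient.out (s := blockSetoid A) B

omit [Fintype A] [DecidableEq A] in
/-- `rep B` lies in `B`. [folklore] -/
theorem blk_rep (B : Block A) : blk A (rep A B) = B := Quotient.out_eq (s := blockSetoid A) B

omit [DecidableEq A] in
/-- The potential of the representative is the potential of the block. [folklore] -/
theorem pot_rep (B : Block A) : pot A (rep A B) = potB A B := by
  rw [← potB_blk, blk_rep]

/-- **The block face `F_B`**: the reducing face through the representative of `B`. [folklore] -/
noncomputable def blockFace (B : Block A) : Ty₂ A → ℤ := redFace A (rep A B)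

/-- **The block span**: the span of the `G`-translates `h·F_B`, `h·x·F_B` over the non-residual blocks `B`. [folklore] -/
def blockSpan : Submodule ℤ (Ty₂ A → ℤ) :=
  Submodule.span ℤ {v | ∃ B : Block A, 2 ≤ potB A B ∧ ∃ g : ZMod 2 × A,
    v = translH A g (blockFace A B) ∨ v = translH A g (translX A (blockFace A B))}

/-- The block span lies in `H₂`. [folklore] -/
theorem blockSpan_le_hodge₂ : blockSpan A ≤ hodge₂ A := by
  refine Submodule.span_le.mpr ?_
  rintro v ⟨B, hB, g, rfl | rfl⟩
  · exact translH_mem A (redFace_mem A (by rw [pot_rep]; exact hB)) g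
  · exact translH_mem A (translX_mem A (redFace_mem A (by rw [pot_rep]; exact hB))) g

/-- **The block span covers every non-residual label** by a potential-reducing vector. [folklore] -/
theorem blockSpan_cover (Ψ : Ty₂ A) (hΨ : 2 ≤ pot A Ψ) :
    ∃ v ∈ blockSpan A, v Ψ = 1 ∧ ∀ χ, χ ≠ Ψ → v χ ≠ 0 → pot A χ < pot A Ψ := by
  have hB : 2 ≤ potB A (blk A Ψ) := by rw [potB_blk]; exact hΨ
  have hr : 2 ≤ pot A (rep A (blk A Ψ)) := by rw [pot_rep]; exact hB
  have hreach := (blk_eq_blk_iff A (rep A (blk A Ψ)) Ψ).mp (blk_rep A (blk A Ψ))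
  obtain ⟨g, hg | hg⟩ := hreach
  · refine ⟨translH A g (blockFace A (blk A Ψ)), Submodule.subset_span ⟨blk A Ψ, hB, g, Or.inl rfl⟩, ?_⟩
    have hc := cover_translH A (redFace_spec A hr) g
    rw [hg] at hc
    exact hc
  · refine ⟨translH A g (translX A (blockFace A (blk A Ψ))), Submodule.subset_span ⟨blk A Ψ, hB, g, Or.inr rfl⟩, ?_⟩
    have hc := cover_translH A (cover_translX A (redFace_spec A hr)) g
    rw [hg] at hc
    exact hc

/-- **The functionals kill the block span** (`|A|` odd). [folklore] -/
theorem killed_of_mem_blockSpan (hA : Odd (Fintype.card A)) {v : Ty₂ A → ℤ} (hv : v ∈ blockSpan A) :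
    ((∀ s, U A s v = 0) ∧ (∀ s, U' A s v = 0) ∧ C₀ A v = 0 ∧ C₁ A v = 0) := by
  refine Submodule.span_induction (p := fun w _ => ((∀ s, U A s w = 0) ∧ (∀ s, U' A s w = 0) ∧ C₀ A w = 0 ∧ C₁ A w = 0)) ?_ ?_ ?_ ?_ hv
  · rintro _ ⟨B, hB, g, rfl | rfl⟩
    · exact killed_translH A hA g (killed_redFace A hA (by rw [pot_rep]; exact hB))
    · exact killed_translH A hA g (killed_translX_redFace A hA (by rw [pot_rep]; exact hB))
  · exact ⟨fun s => map_zero _, fun s => map_zero _, map_zero _, map_zero _⟩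
  · intro x y _ _ hx hy
    exact ⟨fun s => by rw [map_add, hx.1 s, hy.1 s, add_zero], fun s => by rw [map_add, hx.2.1 s, hy.2.1 s, add_zero],
      by rw [map_add, hx.2.2.1, hy.2.2.1, add_zero], by rw [map_add, hx.2.2.2, hy.2.2.2, add_zero]⟩
  · intro c x _ hx
    exact ⟨fun s => by rw [map_smul, hx.1 s, smul_zero], fun s => by rw [map_smul, hx.2.1 s, smul_zero],
      by rw [map_smul, hx.2.2.1, smul_zero], by rw [map_smul, hx.2.2.2, smul_zero]⟩

/-- **GENERATION BY THE FAMILY: `H₂ ≤ P₂ ⊔ blockSpan ⊔ closingSpan`** (`|A|` odd `≥ 3`). [folklore] -/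
theorem hodge₂_le_blockSpan (hA : Odd (Fintype.card A)) (h3 : 3 ≤ Fintype.card A) :
    hodge₂ A ≤ pairs₂ A ⊔ blockSpan A ⊔ closingSpan A :=
  hodge₂_le A hA h3 (blockSpan A) (blockSpan_le_hodge₂ A) (blockSpan_cover A) (fun _ hv => killed_of_mem_blockSpan A hA hv)

/-- **`P₂ ⊔ blockSpan ⊔ closingSpan = H₂`.** [folklore] -/
theorem sup_blockSpan_eq_hodge₂ (hA : Odd (Fintype.card A)) (h3 : 3 ≤ Fintype.card A) :
    pairs₂ A ⊔ blockSpan A ⊔ closingSpan A = hodge₂ A :=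
  le_antisymm (sup_le (sup_le (pairs₂_le_hodge₂ A) (blockSpan_le_hodge₂ A)) (closingSpan_le_hodge₂ A h3)) (hodge₂_le_blockSpan A hA h3)

/-! ## §3 The count: `#family + 1 ≤ β` -/

/-- **The generating family**: the block faces of the non-residual blocks and the two closing squares. [folklore] -/
noncomputable def family : Finset (Ty₂ A → ℤ) :=
  (univ.filter fun B : Block A => 2 ≤ potB A B).image (blockFace A) ∪ {f₁ A, f₂ A}

/-- **The family has at most `β − 1` members**: `#family + 1 ≤ #Block A` (`|A|` odd `≥ 3`). [folklore] -/
theorem card_family_add_one_le (hA : Odd (Fintype.card A)) (h3 : 3 ≤ Fintype.card A) :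
    (family A).card + 1 ≤ Fintype.card (Block A) := by
  have h1 := card_nonresidual_add_three_le A hA h3
  have h2 : (family A).card ≤ ((univ.filter fun B : Block A => 2 ≤ potB A B).image (blockFace A)).card + ({f₁ A, f₂ A} : Finset _).card :=
    Finset.card_union_le _ _
  have h4 : (({f₁ A, f₂ A} : Finset (Ty₂ A → ℤ))).card ≤ 2 := Finset.card_le_two
  have h5 := Finset.card_image_le (s := univ.filter fun B : Block A => 2 ≤ potB A B) (f := blockFace A)
  omega

/-- **The span of the `G`-translates of the family** (`h·f` and `h·x·f`, `f ∈ family`). [folklore] -/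
def familySpan : Submodule ℤ (Ty₂ A → ℤ) :=
  Submodule.span ℤ {v | ∃ f ∈ family A, ∃ g : ZMod 2 × A, v = translH A g f ∨ v = translH A g (translX A f)}

/-- The block faces of non-residual blocks belong to the family. [folklore] -/
theorem blockFace_mem_family {B : Block A} (hB : 2 ≤ potB A B) : blockFace A B ∈ family A := by
  unfold family
  exact Finset.mem_union_left _ (Finset.mem_image_of_mem _ (Finset.mem_filter.mpr ⟨Finset.mem_univ _, hB⟩))

/-- The closing squares belong to the family. [folklore] -/
theorem f_mem_family : f₁ A ∈ family A ∧ f₂ A ∈ family A := by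
  unfold family
  exact ⟨Finset.mem_union_right _ (by simp), Finset.mem_union_right _ (by simp)⟩

/-- `blockSpan ≤ familySpan`. [folklore] -/
theorem blockSpan_le_familySpan : blockSpan A ≤ familySpan A := by
  refine Submodule.span_mono ?_
  rintro v ⟨B, hB, g, hv⟩
  exact ⟨blockFace A B, blockFace_mem_family A hB, g, hv⟩

/-- `closingSpan ≤ familySpan`. [folklore] -/
theorem closingSpan_le_familySpan : closingSpan A ≤ familySpan A := by
  refine Submodule.span_le.mpr ?_
  rintro v ⟨g, rfl | rfl | rfl | rfl⟩
  · exact Submodule.subset_span ⟨f₁ A, (f_mem_family A).1, g, Or.inl rfl⟩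
  · exact Submodule.subset_span ⟨f₂ A, (f_mem_family A).2, g, Or.inl rfl⟩
  · exact Submodule.subset_span ⟨f₁ A, (f_mem_family A).1, g, Or.inr (by rw [translX_f₁])⟩
  · exact Submodule.subset_span ⟨f₂ A, (f_mem_family A).2, g, Or.inr (by rw [translX_f₂])⟩

/-- `familySpan ≤ H₂` (`|A| ≥ 3`). [folklore] -/
theorem familySpan_le_hodge₂ (h3 : 3 ≤ Fintype.card A) : familySpan A ≤ hodge₂ A := by
  obtain ⟨-, -, -, -, huu', -, hu'u''⟩ := closData_spec A h3
  refine Submodule.span_le.mpr ?_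
  rintro v ⟨f, hf, g, rfl | rfl⟩
  · refine translH_mem A ?_ g
    unfold family at hf
    rcases Finset.mem_union.mp hf with hf | hf
    · obtain ⟨B, hB, rfl⟩ := Finset.mem_image.mp hf
      exact redFace_mem A (by rw [pot_rep]; exact (Finset.mem_filter.mp hB).2)
    · rcases Finset.mem_insert.mp hf with rfl | hf
      · exact faceVec₁_mem A _ _ huu'
      · rw [Finset.mem_singleton] at hf; rw [hf]; exact faceVec₁_mem A _ _ hu'u''
  · refine translH_mem A (translX_mem A ?_) g
    unfold family at hf
    rcases Finset.mem_union.mp hf with hf | hf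
    · obtain ⟨B, hB, rfl⟩ := Finset.mem_image.mp hf
      exact redFace_mem A (by rw [pot_rep]; exact (Finset.mem_filter.mp hB).2)
    · rcases Finset.mem_insert.mp hf with rfl | hf
      · exact faceVec₁_mem A _ _ huu'
      · rw [Finset.mem_singleton] at hf; rw [hf]; exact faceVec₁_mem A _ _ hu'u''

/-- **`P₂ ⊔ familySpan = H₂`** (`|A|` odd `≥ 3`). [folklore] -/
theorem sup_familySpan_eq_hodge₂ (hA : Odd (Fintype.card A)) (h3 : 3 ≤ Fintype.card A) :
    pairs₂ A ⊔ familySpan A = hodge₂ A := by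
  refine le_antisymm (sup_le (pairs₂_le_hodge₂ A) (familySpan_le_hodge₂ A h3)) ?_
  refine le_trans (hodge₂_le_blockSpan A hA h3) ?_
  exact sup_le (sup_le le_sup_left (le_trans (blockSpan_le_familySpan A) le_sup_right))
    (le_trans (closingSpan_le_familySpan A) le_sup_right)

/-- **Every member of the family is a rank-four face class**: a `0`-coordinate or `1`-coordinate square at two distinct places, or a mixed
square. [folklore] -/
theorem family_shape (h3 : 3 ≤ Fintype.card A) {f : Ty₂ A → ℤ} (hf : f ∈ family A) :
    (∃ (φ : Ty A) (i j : A) (ψ : Ty A), i ≠ j ∧ (f = faceVec₀ A φ i j ψ ∨ f = faceVec₁ A ψ φ i j)) ∨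
      ∃ (φ : Ty A) (i : A) (ψ : Ty A) (j : A), f = faceVecM A φ i ψ j := by
  obtain ⟨-, -, -, -, huu', -, hu'u''⟩ := closData_spec A h3
  unfold family at hf
  rcases Finset.mem_union.mp hf with hf | hf
  · obtain ⟨B, hB, rfl⟩ := Finset.mem_image.mp hf
    have hr : 2 ≤ pot A (rep A B) := by rw [pot_rep]; exact (Finset.mem_filter.mp hB).2
    unfold blockFace
    generalize rep A B = Ψ at hr
    obtain ⟨ψ₀, ψ₁⟩ := Ψ
    have hp : pot A (ψ₀, ψ₁) = clsTy A ψ₀ + clsTy A ψ₁ := rfl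
    by_cases h0 : 2 ≤ clsTy A ψ₀
    · obtain ⟨eP, eF⟩ := redFace_eq₀ A (ψ₁ := ψ₁) h0
      have hij := (exists_two_reducing A h0).choose_spec.1
      rw [eF, eP]
      exact Or.inl ⟨_, _, _, _, hij, Or.inl rfl⟩
    · by_cases h1 : 2 ≤ clsTy A ψ₁
      · obtain ⟨eP, eF⟩ := redFace_eq₁ A h0 h1
        have hij := (exists_two_reducing A h1).choose_spec.1
        rw [eF, eP]
        exact Or.inl ⟨_, _, _, _, hij, Or.inr rfl⟩
      · have h2 : clsTy A ψ₀ = 1 ∧ clsTy A ψ₁ = 1 := by rw [hp] at hr; omega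
        obtain ⟨-, eF⟩ := redFace_eqM A h0 h1 h2
        rw [eF]
        exact Or.inr ⟨_, _, _, _, rfl⟩
  · rcases Finset.mem_insert.mp hf with rfl | hf
    · exact Or.inl ⟨_, _, _, _, huu', Or.inr rfl⟩
    · rw [Finset.mem_singleton] at hf; rw [hf]
      exact Or.inl ⟨_, _, _, _, hu'u'', Or.inr rfl⟩

/-- **MAIN COUNT THEOREM of the dicyclic twist** (`|A|` odd `≥ 3`): there is a finite family of rank-four face classes (`0`-coordinate,
`1`-coordinate or mixed squares) with **at most `β − 1` members** whose `G`-translates, together with the pairs, span the Hodge lattice `H₂`.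
[folklore] -/
theorem exists_generating_family (hA : Odd (Fintype.card A)) (h3 : 3 ≤ Fintype.card A) :
    ∃ fam : Finset (Ty₂ A → ℤ), fam.card + 1 ≤ Fintype.card (Block A) ∧
      (∀ f ∈ fam, (∃ (φ : Ty A) (i j : A) (ψ : Ty A), i ≠ j ∧ (f = faceVec₀ A φ i j ψ ∨ f = faceVec₁ A ψ φ i j)) ∨
        ∃ (φ : Ty A) (i : A) (ψ : Ty A) (j : A), f = faceVecM A φ i ψ j) ∧
      pairs₂ A ⊔ Submodule.span ℤ {v | ∃ f ∈ fam, ∃ g : ZMod 2 × A, v = translH A g f ∨ v = translH A g (translX A f)} = hodge₂ A :=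
  ⟨family A, card_family_add_one_le A hA h3, fun _ hf => family_shape A h3 hf, sup_familySpan_eq_hodge₂ A hA h3⟩

end Summit.HodgeConjecture.CorCM.Census.DicyclicTwist
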